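import Summits.Parity.GeneralizedHardyLittlewood.Theses.HullDial
import Literature.NumberTheory.Sieve.SieveFrameworkFundamentalLemma

/-!
# Birth skeleton (BC3) for crux `DialSieveWeights` — route HullDial, item stmt-Parity-13091

Line `birth` = the route's own expected proof, cut at its three classical joints
(combinatorial step / analytic lower step / analytic upper step of a β-sieve theorem, exactly the
organisation of Iwaniec's Theorem 1 in the tree: `BetaSieve.lower_sieve`/`upper_sieve` proved,
`Iwaniec1980_mainTerm_lower/upper` the analytic halves).

**Idea.** Take for `λ±` ROSSER'S `β = 1` WEIGHTS of level `D = x^θ` over the sifting range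
`P(√x)`: `λ⁻_d = μ(d) χ⁻_D(d)`, `λ⁺_d = μ(d) χ⁺_D(d)` with `χ^{par} = BetaSieve.ind par 1 D`
(tree `SieveFrameworkFundamentalLemma.lean`: keep `d = p₁ ⋯ p_r`, `p₁ > ⋯ > p_r`, iff
`p₁ ⋯ p_m · p_m < D` at every position `m ≡ par (mod 2)`). These are the weights the route's
docstring names ("Rosser's β = 1 truncations, tree BetaSieve.pred/ind") and the lower one is the
`χ⁻` of the support item `DegreeEightPositivity`. Then `DialSieveWeights` (∃ weights with
|λ| ≤ 1, support `d ∣ P(√x)`, `d ≤ x^θ`, the pointwise sieve inequalities, and main terms within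
`(1 ± ε) V*`) follows from three stubs by pure logic (`DialSieveWeights_of`, kernel-checked):

* `stub_rosserSieve` (S/M, provable now from the tree): for `θ > 1/2` and all large `x`, the
  weights satisfy `∑_(d ∣ m) λ⁻_d ≤ 1_((m, P(√x)) = 1) ≤ ∑_(d ∣ m) λ⁺_d` for every `m ≥ 1`.
  Why plausible: `BetaSieve.lower_sieve` / `upper_sieve` (Greaves Lemma 3.1.1, PROVED in the tree,
  valid for every `β`, `D`) applied to `n = (m, P(√x))` (squarefree), plus the level property
  `BetaSieve.lt_level_of_pred_of_one_le` (`β ≥ 1`, `z ≤ D`: here `z = √x ≤ x^θ = D`), which shows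
  the extra truncation `d ≤ x^θ` in `wLo`/`wUp` removes nothing. Leans on: those three tree
  theorems, `primorial` = product of the primes `< √x` (squarefree).
* `stub_lowerMainTerm` (L, the HARDEST): for every `ε`, `θ ∈ (1/2,1)` there is `k₀` with, for
  `k ≥ k₀`, even `h`, large `x`, primes `ℓ ≤ (log x)^8`, `k ∣ ℓ−1`, `ℓ > h`:
  `∑_(d ∣ P(√x)) λ⁻_d G_x(d) ≥ (1 − ε) V*(x)`.
  Why plausible (configuration count, this seat): with `s = log D / log z = 2θ ∈ (1,2)` FIXED (`z = √x`)
  and Rosser's `β = 1` sets, `θ⁻(m) = ∑_(d∣m) λ⁻_d` is EXACT (`= 1_survivor`), up to the classical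
  fundamental-lemma error in the primes `< z^η` (`→ 0` with `η`, uniformly in `κ ≤ 1/2`), on every `m`
  whose `P(√x)`-part has at most one prime `≥ z^η`, and equals `−1` exactly on `m` whose large part is
  `p₁ p₂` with `p₁ p₂² ≥ D` (region `u₁ + 2u₂ ≥ s`, `u₂ < u₁ < 1`, `u = log p / log z`, bounded away
  from `0`); so the relative loss is the model mass of two LARGE split primes in that region,
  `≍ κ²·C(s)` with `κ` the local dimension `≤ 4·2^(1−1/k)/k → 0` — the `O(κ²)` of the route docstring,
  NOT the fundamental lemma with `b → ∞` (this answers grounder g27-24's `K^(1+b)` objection: no `b`,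
  no `K`; the expansion is in the number of large prime factors, `1 − f = C₂(s)κ² + C₃(s)κ³ + …`, and
  for `κ < 1/2` Rosser's `f_κ(1⁺) > 0`: the continuous `β = 1` system has boundary value `B > 0`). The identification of the full functional
  with `V* = (π_H/#N)²·Π_split HL_h(p)`: the `G`-model is the independent-two-hull-numbers model
  corrected to "exactly one colour per prime `p ∤ h`", whose single-colour survival is `π_H/#N` by the
  Legendre identity for the hull + Landau–Selberg–Delange (`#N(x/e)/#N(x) = T_x(e)/e (1+O(1/log x))`,
  uniformly in `ℓ ≤ (log x)^8`, Siegel–Walfisz range) and whose pair/independent ratio is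
  `Π_p (1 − 2T/p)/(1 − T/p)² = Π_split HL_h(p)·(1 + O(Σ_p (T_p² − 1)/p²)) → HL` (first order in
  `T − 1` cancels). Why it might fail: the two-colour tilted Buchstab bookkeeping must be done state
  by state (G is x-dependent and non-multiplicative); LSD uniformity in `ℓ ≤ (log x)^8` for the real
  character of order `k`; a boundary loss not `→ 0` as `κ → 0` at `s < 2` would kill it (cheapest
  falsifier below). Size L. Leans on: tree `RosserSieveRecurrencesBetaOne` (β = 1 continuous models),
  `BetaSieve.sum_moebius_ind_eq` (Buchstab step), `siegel_walfisz_holds`; Tenenbaum2015 II.5 (LSD,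
  not in tree); IwaniecActaArith1980 §§4–9.
* `stub_upperMainTerm` (M/L): same quantifiers, `∑_(d ∣ P(√x)) λ⁺_d G_x(d) ≤ (1 + ε) V*(x)`.
  Why plausible: `χ⁺` over-counts exactly the `m` with ONE large split prime `p ∈ (D^(1/2), z)`,
  i.e. `u ∈ (s/2, 1)` = `(θ, 1)` in `z`-units: relative excess `≍ κ log(2/s) + O(κ²) → 0` (the
  route's `O(κ log(2/s))`); plus the same identification with `V*`. Easier than the lower stub
  (one-prime configurations; alternatively Selberg's sieve gives the same order). Size M/L.

**Hardest stub:** `stub_lowerMainTerm` (two-large-prime region + the `V*` identification).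

**Barriers.** SelbergParityBarrier / PrimePairParity: not engaged by this line — all three stubs are
statements about EXPLICIT finite sums (`G`, `χ±`, `V*` are closed forms; `π_H`, `#N` are
unconditional counts), no prime-pair lower bound is deduced here; the parity content of the route sits
in `HullPairsLevel`/`HullPairsMass`, untouched. LargeSieveLevelHalf: not engaged (no level of
distribution is claimed; `θ` is a free parameter of explicit sums).

**Disproof used:** none exists for this crux (`ledger crux ls stmt-Parity-13091`: no workfiles, no
`Disproof.lean`, 2026-08-17); negatives index for Parity (convolution-moment / rectangle-Chowla
statements) is not touched by any stub. **Dead lines:** none recorded for this crux.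

**Cheapest falsifier** (= the route's kit item (1), sharpened): solve the two-colour tilted `β = 1`
Rosser recursion numerically for `k ∈ {8,16,32,64}`, `s = 2θ ∈ [1.02, 2)`: the lower ratio must
behave like `1 − C(s)/k²` and the upper like `1 + C'(s)/k`; a loss bounded below as `k → ∞` kills
`stub_lowerMainTerm` (and the crux's dial with it).

**How to discharge Stub 1 (hint).** `∑_(d ∣ m) wLo θ x d = ∑_(d ∣ (m, P(√x))) μ(d) χ⁻(d)`: the
cut `d ≤ x^θ` is void on the support of `χ⁻` by `BetaSieve.lt_level_of_pred_of_one_le` (β = 1,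
`z = D = x^θ`, prime factors `< √x ≤ x^θ`, `1 < x^θ`), then `BetaSieve.lower_sieve` at the squarefree
`n = (m, P(√x))` (`primorial` is squarefree) and `Nat.Coprime m P ↔ (m, P) = 1`; the upper half alike.

**BC3 audit (this seat, 2026-08-17):** `lean check` rc 0, placeholders only in the three stubs;
probes `stub → DialSieveWeights` and `stub → GeneralizedHardyLittlewood` by
`first | exact? | simpa | aesop` FAIL for all three stubs (self-contained files `bc/probe_*.lean` in the
seat folder — no sibling stub or `_of` in scope —, rc 1 "unsolved goals", aesop exhaustive search failed;
outputs in the seat's NOTES.md).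
-/

namespace Summit.Parity.GeneralizedHardyLittlewood.Cruxes.DialSieveWeights.Birth

open scoped BigOperators Topology Manifold Classical MeasureTheory ProbabilityTheory Matrix InnerProductSpace ComplexConjugate ContinuousMap
open Filter Set Function TopologicalSpace MeasureTheory

/-! ### The model objects of the crux, verbatim

These are the `let`-bound objects of `HullDial.DialSieveWeights`, copied symbol for symbol with the two
predicates `res ℓ k u := ∃ v : ZMod ℓ, v ≠ 0 ∧ v ^ k = u` ("`u` is a non-zero `k`-th power mod `ℓ`", the
split classes `H`) and `hull ℓ k n := ∀ p ∈ n.primeFactors, res ℓ k p` (the hull `N_(ℓ,k)`) written out in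
place, so that no proposition is defined in this file and the elaborated terms (decidability instances
included) coincide with the route's: the restated crux in `dialSieveWeights_explicit_of` is accepted at type
`HullDial.DialSieveWeights` by definitional unfolding alone (`DialSieveWeights_of`). -/

/-- The tilt `T_x(e) = (1 − log e / log x)^(−(1 − 1/k))`. -/
noncomputable def T (k : ℕ) (x : ℝ) (e : ℕ) : ℝ :=
  (1 - Real.log (e : ℝ) / Real.log x) ^ (-(1 - 1 / (k : ℝ)))

/-- The tilted two-colour pair density `G_x(d)` of the route (zero off squarefree split-composed `d`). -/
noncomputable def G (ℓ k h : ℕ) (x : ℝ) (d : ℕ) : ℝ :=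
  if Squarefree d ∧ (∀ p ∈ d.primeFactors, (∃ v : ZMod ℓ, v ≠ 0 ∧ v ^ k = ((p : ℕ) : ZMod ℓ))) then (1 / (d : ℝ)) * ∑ e ∈ (d / Nat.gcd d h).divisors, T k x (Nat.gcd d h * e) * T k x (Nat.gcd d h * (d / Nat.gcd d h / e)) else 0

/-- `#N(x)`: hull numbers `≤ x` (all prime factors in the split classes). -/
noncomputable def Ncount (ℓ k : ℕ) (x : ℝ) : ℝ :=
  (((Finset.Icc 1 ⌊x⌋₊).filter (fun n => ∀ p ∈ n.primeFactors, (∃ v : ZMod ℓ, v ≠ 0 ∧ v ^ k = ((p : ℕ) : ZMod ℓ)))).card : ℝ)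

/-- `π_H(x)`: primes `≤ x` in the split classes. -/
noncomputable def piH (ℓ k : ℕ) (x : ℝ) : ℝ :=
  (((Finset.Icc 1 ⌊x⌋₊).filter (fun p => p.Prime ∧ (∃ v : ZMod ℓ, v ≠ 0 ∧ v ^ k = ((p : ℕ) : ZMod ℓ)))).card : ℝ)

/-- The Hardy–Littlewood target `V*(x) = (π_H/#N)² · Π_(split p < √x) HL_h(p)`. -/
noncomputable def Vstar (ℓ k h : ℕ) (x : ℝ) : ℝ :=
  (piH ℓ k x / Ncount ℓ k x) ^ 2 * ∏ p ∈ (primorial (⌈Real.sqrt x⌉₊ - 1)).primeFactors.filter (fun p => (∃ v : ZMod ℓ, v ≠ 0 ∧ v ^ k = ((p : ℕ) : ZMod ℓ))), (1 - (if p ∣ h then (1 : ℝ) else 2) / (p : ℝ)) / (1 - 1 / (p : ℝ)) ^ 2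

/-! ### The line's weights: Rosser's `β = 1` truncations at level `x^θ` over `P(√x)` -/

/-- The sifting range `P(√x) = ∏_(p < √x) p`, verbatim the route's `primorial (⌈√x⌉₊ − 1)`. -/
noncomputable abbrev P (x : ℝ) : ℕ := primorial (⌈Real.sqrt x⌉₊ - 1)

/-- Rosser's LOWER weight `λ⁻_d = μ(d) χ⁻_D(d)` (`χ⁻ = BetaSieve.ind 0 1 D`, i.e. `β = 1`, even
positions: `p₁ ⋯ p_m · p_m < D`), level `D = x^θ`, restricted to `d ∣ P(√x)`, `d ≤ x^θ` (the second
restriction is implied by Rosser's conditions once `√x ≤ x^θ`; it is kept so that the support clause of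
the crux holds by definition). -/
noncomputable def wLo (θ x : ℝ) (d : ℕ) : ℝ :=
  if d ∣ P x ∧ (d : ℝ) ≤ x ^ θ then
    (ArithmeticFunction.moebius d : ℝ) * Literature.NumberTheory.Sieve.BetaSieve.ind 0 1 (x ^ θ) d
  else 0

/-- Rosser's UPPER weight `λ⁺_d = μ(d) χ⁺_D(d)` (`χ⁺ = BetaSieve.ind 1 1 D`: odd positions), level
`D = x^θ`, restricted to `d ∣ P(√x)`, `d ≤ x^θ`. -/
noncomputable def wUp (θ x : ℝ) (d : ℕ) : ℝ :=
  if d ∣ P x ∧ (d : ℝ) ≤ x ^ θ then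
    (ArithmeticFunction.moebius d : ℝ) * Literature.NumberTheory.Sieve.BetaSieve.ind 1 1 (x ^ θ) d
  else 0

/-! ### Size and support of the weights (immediate from the definitions; proved) -/

theorem abs_wLo_le_one (θ x : ℝ) (d : ℕ) : |wLo θ x d| ≤ 1 := by
  unfold wLo
  split_ifs
  · rw [abs_mul]
    have hμ : |(ArithmeticFunction.moebius d : ℝ)| ≤ 1 := by
      exact_mod_cast ArithmeticFunction.abs_moebius_le_one
    exact mul_le_one₀ hμ (abs_nonneg _) (Literature.NumberTheory.Sieve.BetaSieve.abs_ind_le_one d)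
  · simp

theorem abs_wUp_le_one (θ x : ℝ) (d : ℕ) : |wUp θ x d| ≤ 1 := by
  unfold wUp
  split_ifs
  · rw [abs_mul]
    have hμ : |(ArithmeticFunction.moebius d : ℝ)| ≤ 1 := by
      exact_mod_cast ArithmeticFunction.abs_moebius_le_one
    exact mul_le_one₀ hμ (abs_nonneg _) (Literature.NumberTheory.Sieve.BetaSieve.abs_ind_le_one d)
  · simp

theorem wLo_eq_zero_of {θ x : ℝ} {d : ℕ} (h : ¬ d ∣ P x ∨ x ^ θ < (d : ℝ)) : wLo θ x d = 0 := by
  unfold wLo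
  rw [if_neg]
  rintro ⟨h1, h2⟩
  rcases h with h | h
  · exact h h1
  · exact absurd h2 (not_le.mpr h)

theorem wUp_eq_zero_of {θ x : ℝ} {d : ℕ} (h : ¬ d ∣ P x ∨ x ^ θ < (d : ℝ)) : wUp θ x d = 0 := by
  unfold wUp
  rw [if_neg]
  rintro ⟨h1, h2⟩
  rcases h with h | h
  · exact h h1
  · exact absurd h2 (not_le.mpr h)

/-! ### Registered stub signatures

Named copies of the three stub statements (`Signature.stub_<name>`, last name component = the stub's name), so
that the hypotheses of `DialSieveWeights_of` are the declared stubs BY NAME for the layer-invariant audit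
(`#h21_check_skeleton`); each `theorem stub_<name>` below states the same text in full. -/

/-- Signature of `stub_rosserSieve` (the combinatorial step). -/
def Signature.stub_rosserSieve : Prop :=
    ∀ θ : ℝ, 1 / 2 < θ → ∀ᶠ x : ℝ in Filter.atTop, ∀ m : ℕ, 1 ≤ m →
      ∑ d ∈ m.divisors, wLo θ x d ≤ (if Nat.Coprime m (P x) then (1 : ℝ) else 0) ∧
        (if Nat.Coprime m (P x) then (1 : ℝ) else 0) ≤ ∑ d ∈ m.divisors, wUp θ x d

/-- Signature of `stub_lowerMainTerm` (the analytic lower step). -/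
def Signature.stub_lowerMainTerm : Prop :=
    ∀ ε : ℝ, 0 < ε → ∀ θ : ℝ, 1 / 2 < θ → θ < 1 → ∃ k₀ : ℕ, ∀ k : ℕ, k₀ ≤ k →
      ∀ h : ℕ, 1 ≤ h → Even h → ∀ᶠ x : ℝ in Filter.atTop, ∀ ℓ : ℕ, ℓ.Prime →
        (ℓ : ℝ) ≤ Real.log x ^ 8 → k ∣ ℓ - 1 → h < ℓ →
          (1 - ε) * Vstar ℓ k h x ≤ ∑ d ∈ (P x).divisors, wLo θ x d * G ℓ k h x d

/-- Signature of `stub_upperMainTerm` (the analytic upper step). -/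
def Signature.stub_upperMainTerm : Prop :=
    ∀ ε : ℝ, 0 < ε → ∀ θ : ℝ, 1 / 2 < θ → θ < 1 → ∃ k₀ : ℕ, ∀ k : ℕ, k₀ ≤ k →
      ∀ h : ℕ, 1 ≤ h → Even h → ∀ᶠ x : ℝ in Filter.atTop, ∀ ℓ : ℕ, ℓ.Prime →
        (ℓ : ℝ) ≤ Real.log x ^ 8 → k ∣ ℓ - 1 → h < ℓ →
          ∑ d ∈ (P x).divisors, wUp θ x d * G ℓ k h x d ≤ (1 + ε) * Vstar ℓ k h x

/-! ### The stubs -/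

/-- **Stub 1 (combinatorial step; S/M).** Rosser's `β = 1` weights of level `x^θ` over `P(√x)`
satisfy the pointwise lower/upper sieve inequalities for every `m ≥ 1`, once `x` is large
(`√x ≤ x^θ`, `1 < x^θ`). Tree: `BetaSieve.lower_sieve`, `BetaSieve.upper_sieve` (any `β`, `D`) at
`n = (m, P(√x))`, and `BetaSieve.lt_level_of_pred_of_one_le` for the redundant cut `d ≤ x^θ`.
[cite: Greaves2001, §3.1.2 Lemma 1; IwaniecActaArith1980, (3.6)–(3.7)] -/
theorem stub_rosserSieve :
    ∀ θ : ℝ, 1 / 2 < θ → ∀ᶠ x : ℝ in Filter.atTop, ∀ m : ℕ, 1 ≤ m →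
      ∑ d ∈ m.divisors, wLo θ x d ≤ (if Nat.Coprime m (P x) then (1 : ℝ) else 0) ∧
        (if Nat.Coprime m (P x) then (1 : ℝ) else 0) ≤ ∑ d ∈ m.divisors, wUp θ x d := by
  sorry

/-- **Stub 2 (analytic lower step; L — the hardest).** DIMENSION → 0 MAKES ROSSER'S LOWER SIEVE
EXACT FOR THE TILTED TWO-COLOUR MODEL: the `β = 1` lower main sum against `G_x` is `≥ (1 − ε) V*`
for `k ≥ k₀(ε, θ)`, uniformly in the auxiliary prime `ℓ ≤ (log x)^8`. Loss = model mass of two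
large split primes with `p₁ p₂² ≥ x^θ` (`≍ C(2θ)·κ²`, `κ ≤ 4·2^(1−1/k)/k`), plus the identification
of the full functional with `V*` (Legendre identity for the hull + Landau–Selberg–Delange uniformly in
`ℓ`, and `Π_p (1 − 2T/p)/(1 − T/p)² → Π_split HL_h(p)`).
[cite: IwaniecActaArith1980, §§4–9; HalberstamRichert1974, Thm 2.5; Tenenbaum2015, II.5 Thm 5.2] -/
theorem stub_lowerMainTerm :
    ∀ ε : ℝ, 0 < ε → ∀ θ : ℝ, 1 / 2 < θ → θ < 1 → ∃ k₀ : ℕ, ∀ k : ℕ, k₀ ≤ k →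
      ∀ h : ℕ, 1 ≤ h → Even h → ∀ᶠ x : ℝ in Filter.atTop, ∀ ℓ : ℕ, ℓ.Prime →
        (ℓ : ℝ) ≤ Real.log x ^ 8 → k ∣ ℓ - 1 → h < ℓ →
          (1 - ε) * Vstar ℓ k h x ≤ ∑ d ∈ (P x).divisors, wLo θ x d * G ℓ k h x d := by
  sorry

/-- **Stub 3 (analytic upper step; M/L).** The `β = 1` upper main sum against `G_x` is
`≤ (1 + ε) V*` for `k ≥ k₀(ε, θ)`: `χ⁺` over-counts exactly the configurations with one large split
prime `p` with `p² ≥ x^θ`, i.e. `log p / log √x ∈ (θ, 1)`, relative excess `≍ κ log(1/θ) + O(κ²) → 0`,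
plus the same `V*` identification. [cite: IwaniecActaArith1980, §§4–9; FriedlanderIwaniecOpera2010, §6, §11] -/
theorem stub_upperMainTerm :
    ∀ ε : ℝ, 0 < ε → ∀ θ : ℝ, 1 / 2 < θ → θ < 1 → ∃ k₀ : ℕ, ∀ k : ℕ, k₀ ≤ k →
      ∀ h : ℕ, 1 ≤ h → Even h → ∀ᶠ x : ℝ in Filter.atTop, ∀ ℓ : ℕ, ℓ.Prime →
        (ℓ : ℝ) ≤ Real.log x ^ 8 → k ∣ ℓ - 1 → h < ℓ →
          ∑ d ∈ (P x).divisors, wUp θ x d * G ℓ k h x d ≤ (1 + ε) * Vstar ℓ k h x := by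
  sorry

/-! ### The assembly (real proof) -/

/-- The three stubs give the crux with its `let`s written out over the named objects: take `k₀ = max` of
the two thresholds, intersect the three `∀ᶠ x` sets, and offer Rosser's weights `wLo θ x`, `wUp θ x`. -/
theorem dialSieveWeights_explicit_of
    (hR : ∀ θ : ℝ, 1 / 2 < θ → ∀ᶠ x : ℝ in Filter.atTop, ∀ m : ℕ, 1 ≤ m →
      ∑ d ∈ m.divisors, wLo θ x d ≤ (if Nat.Coprime m (P x) then (1 : ℝ) else 0) ∧
        (if Nat.Coprime m (P x) then (1 : ℝ) else 0) ≤ ∑ d ∈ m.divisors, wUp θ x d)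
    (hL : ∀ ε : ℝ, 0 < ε → ∀ θ : ℝ, 1 / 2 < θ → θ < 1 → ∃ k₀ : ℕ, ∀ k : ℕ, k₀ ≤ k →
      ∀ h : ℕ, 1 ≤ h → Even h → ∀ᶠ x : ℝ in Filter.atTop, ∀ ℓ : ℕ, ℓ.Prime →
        (ℓ : ℝ) ≤ Real.log x ^ 8 → k ∣ ℓ - 1 → h < ℓ →
          (1 - ε) * Vstar ℓ k h x ≤ ∑ d ∈ (P x).divisors, wLo θ x d * G ℓ k h x d)
    (hU : ∀ ε : ℝ, 0 < ε → ∀ θ : ℝ, 1 / 2 < θ → θ < 1 → ∃ k₀ : ℕ, ∀ k : ℕ, k₀ ≤ k →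
      ∀ h : ℕ, 1 ≤ h → Even h → ∀ᶠ x : ℝ in Filter.atTop, ∀ ℓ : ℕ, ℓ.Prime →
        (ℓ : ℝ) ≤ Real.log x ^ 8 → k ∣ ℓ - 1 → h < ℓ →
          ∑ d ∈ (P x).divisors, wUp θ x d * G ℓ k h x d ≤ (1 + ε) * Vstar ℓ k h x) :
    ∀ ε : ℝ, 0 < ε → ∀ θ : ℝ, 1 / 2 < θ → θ < 1 → ∃ k₀ : ℕ, ∀ k : ℕ, k₀ ≤ k → ∀ h : ℕ, 1 ≤ h → Even h → ∀ᶠ x : ℝ in Filter.atTop, ∀ ℓ : ℕ, ℓ.Prime → (ℓ : ℝ) ≤ Real.log x ^ 8 → k ∣ ℓ - 1 → h < ℓ → ∃ wL wU : ℕ → ℝ, (∀ d : ℕ, |wL d| ≤ 1 ∧ |wU d| ≤ 1) ∧ (∀ d : ℕ, (¬ d ∣ primorial (⌈Real.sqrt x⌉₊ - 1) ∨ x ^ θ < (d : ℝ)) → wL d = 0 ∧ wU d = 0) ∧ (∀ m : ℕ, 1 ≤ m → ∑ d ∈ m.divisors, wL d ≤ (if Nat.Coprime m (primorial (⌈Real.sqrt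 x⌉₊ - 1)) then (1 : ℝ) else 0) ∧ (if Nat.Coprime m (primorial (⌈Real.sqrt x⌉₊ - 1)) then (1 : ℝ) else 0) ≤ ∑ d ∈ m.divisors, wU d) ∧ (1 - ε) * Vstar ℓ k h x ≤ ∑ d ∈ (primorial (⌈Real.sqrt x⌉₊ - 1)).divisors, wL d * G ℓ k h x d ∧ ∑ d ∈ (primorial (⌈Real.sqrt x⌉₊ - 1)).divisors, wU d * G ℓ k h x d ≤ (1 + ε) * Vstar ℓ k h x := by
  intro ε hε θ hθ₁ hθ₂
  obtain ⟨kL, hkL⟩ := hL ε hε θ hθ₁ hθ₂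
  obtain ⟨kU, hkU⟩ := hU ε hε θ hθ₁ hθ₂
  refine ⟨max kL kU, ?_⟩
  intro k hk h hh hhe
  have eR := hR θ hθ₁
  have eL := hkL k ((le_max_left kL kU).trans hk) h hh hhe
  have eU := hkU k ((le_max_right kL kU).trans hk) h hh hhe
  filter_upwards [eR, eL, eU] with x hxR hxL hxU
  intro ℓ hℓ hℓx hkℓ hhℓ
  exact ⟨wLo θ x, wUp θ x, fun d => ⟨abs_wLo_le_one θ x d, abs_wUp_le_one θ x d⟩,
    fun d hd => ⟨wLo_eq_zero_of hd, wUp_eq_zero_of hd⟩, fun m hm => hxR m hm,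
    hxL ℓ hℓ hℓx hkℓ hhℓ, hxU ℓ hℓ hℓx hkℓ hhℓ⟩

/-- **BC3 composition.** `stub_rosserSieve → stub_lowerMainTerm → stub_upperMainTerm → DialSieveWeights`:
the hypotheses are the three registered stub signatures BY NAME (`Signature.stub_*`, definitionally the statements of
the `stub_*` theorems) and the conclusion is literally the route decl `HullDial.DialSieveWeights` (the explicit
form is accepted at that type by `let`-zeta and unfolding of `T`, `G`, `Ncount`, `piH`, `Vstar`); a complete
proof term, axioms `propext`, `Classical.choice`, `Quot.sound` only. -/
theorem DialSieveWeights_of :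
    Signature.stub_rosserSieve → Signature.stub_lowerMainTerm → Signature.stub_upperMainTerm →
      Summit.Parity.GeneralizedHardyLittlewood.Theses.HullDial.DialSieveWeights :=
  fun hR hL hU => dialSieveWeights_explicit_of hR hL hU

/-- The skeleton instantiated: the crux BY NAME modulo the three registered stubs (carries their `sorry`s,
nothing else). -/
theorem DialSieveWeights_of_stubs :
    Summit.Parity.GeneralizedHardyLittlewood.Theses.HullDial.DialSieveWeights :=
  DialSieveWeights_of stub_rosserSieve stub_lowerMainTerm stub_upperMainTerm

end Summit.Parity.GeneralizedHardyLittlewood.Cruxes.DialSieveWeights.Birth
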